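import Mathlib
import Summits.Ventures.PercRepro2.HCov
import Summits.Ventures.PercRepro2.A3Inactive
import Summits.Ventures.PercRepro2.PMPendantLeaf
import Summits.Ventures.PercRepro2.PMPendantMasses

/-!
# THE WEIGHTED (PM) DICTIONARY: the covariance form is quadratic in the weight of a pendant `a₃`,
and its middle coefficient is the weighted (PM) bracket
(blind cell PercRepro2, mine-2 g22; row 2′BETA1; proofs/MINE2-CUTU.md §13; the weighted shadow of
night-3's `typedCount_pendant_a3_quadratic` / `typedCount_pendant_a3_of_PM`)

Let `a₃` be a leaf with its only edge `f = {a₃, u}` of weight `t = p f`, and write `p₀ = p[f ↦ 0]`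
(`a₃` isolated), `p₁ = p[f ↦ 1]` (`a₃` glued to `u`).  Every mass of `Gc` is affine in `t`
(`PMPendantMasses.lean`), each product of `Gc` has at most two `a₃`-active factors, so

  **`Gc_pendant_quadratic`**: `Gc(p) = (1 − t)² · Gc(p₀) + t (1 − t) · 2β₁′ + t² · Gc(p₁)`,

with `2β₁′ = twoBeta1 p₀ …` explicit in the masses of `Gc` at `p₀` (`a₃ := u` for the `a₃`-active ones).
The three coefficients: **`Gc_pendant_zero_eq`** — `Gc(p₀) = 2 P(Q) [S(bL, oH) + S(bH, oL)]`, the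
`a₃`-inactive value, `≥ 0` by BHK 1.4 (`Gc_pendant_zero_nonneg`; `A3Inactive.lean`); **`Gc_pendant_one`**
— `Gc(p₁)` is `Gc` at `p₀` with `u` in the place of `a₃` (the base instance); and `β₁′`, the weighted (PM)
bracket of row 2′BETA1 (mine-2's `β₁ = (HALF-PM⁺)_L + (HALF-PM⁺)_H + A`, M2-35 — the same number, here
in `Gc`'s vocabulary; on `K₅` kernel-checked `≥ 0` in `PMK5Theorem.lean`).

**`HCov_pendant_of_PM`**: `0 ≤ 2β₁′` and (HCOV) for the base instance `(p₀, a₃ := u)` give (HCOV) for the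
pendant instance `(p, a₃)` — the weighted analogue of `typedCount_pendant_a3_of_PM`, with the
`a₃`-inactive class a THEOREM (BHK 1.4) where the typed chain needs `TB14`.
-/

namespace Summit.Ventures.PercRepro2

open CovForm UnionCluster

namespace PMPendant

section Collapse

variable {V : Type*} {E : Type*} [Fintype E] [DecidableEq E] [DecidableEq V]
  {R : Type*} [Field R] [LinearOrder R]
  {ends : E → Sym2 V} {a₃ u : V} {f : E}
  (hf : ends f = s(a₃, u)) (hleaf : ∀ e, a₃ ∈ ends e → e = f) (h3u : a₃ ≠ u)
  (p : E → R) (a₁ a₂ : V)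
include hf hleaf h3u

omit [DecidableEq V] [LinearOrder R] in
/-- With the leaf edge closed, `PD ∩ Y` is `Q ∩ Y` (the isolated `a₃` is never in `U`). -/
lemma prob_PD_zero (h31 : a₁ ≠ a₃) (h32 : a₂ ≠ a₃) (Y : Set (Config E)) :
    prob (Function.update p f 0) (PDEvent ends a₁ a₂ a₃ ∩ Y) =
      prob (Function.update p f 0) (avoidAll ends a₂ {a₁} ∩ Y) := by
  refine prob_zero_eq p fun ω hω => ?_
  have hs : Conn ends ω a₁ a₂ ↔ Conn ends ω a₂ a₁ := ⟨conn_symm, conn_symm⟩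
  simp only [PDEvent, Dtilde, Set.mem_inter_iff, Set.mem_compl_iff, mem_inU, mem_connEvent,
    mem_avoidAll, Finset.mem_singleton, forall_eq, conn_leaf_closed_iff' hf hleaf h3u hω h31,
    conn_leaf_closed_iff' hf hleaf h3u hω h32, or_self, not_false_eq_true, and_true, hs]

omit [DecidableEq V] [LinearOrder R] in
/-- With the leaf edge closed, `PD` is `Q`. -/
lemma prob_PD_zero' (h31 : a₁ ≠ a₃) (h32 : a₂ ≠ a₃) :
    prob (Function.update p f 0) (PDEvent ends a₁ a₂ a₃) =
      prob (Function.update p f 0) (avoidAll ends a₂ {a₁}) := by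
  refine prob_zero_eq p fun ω hω => ?_
  have hs : Conn ends ω a₁ a₂ ↔ Conn ends ω a₂ a₁ := ⟨conn_symm, conn_symm⟩
  simp only [PDEvent, Dtilde, Set.mem_inter_iff, Set.mem_compl_iff, mem_inU, mem_connEvent,
    mem_avoidAll, Finset.mem_singleton, forall_eq, conn_leaf_closed_iff' hf hleaf h3u hω h31,
    conn_leaf_closed_iff' hf hleaf h3u hω h32, or_self, not_false_eq_true, and_true, hs]

end Collapse

section Dict

variable {V : Type*} {E : Type*} [Fintype E] [DecidableEq E] [DecidableEq V]
  {R : Type*} [Field R] [LinearOrder R]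

/-- **Twice the middle Bernstein coefficient of `Gc` in the pendant weight**, in the masses of `Gc` at
`p₀` (`a₃` isolated): `q = P(Q)`, the `a₃`-free masses `E_Q[σ_bσ_o]`, `gap`, `E_Q[σ_o]`, the isolated
masses `P(PD)`, `D_o`, `P(PD, b ∈ U)`, `P(PD, b ∈ U, o ∈ U)` at `a₃`, and the glued masses at `u`. -/
noncomputable def twoBeta1 (p₀ : E → R) (ends : E → Sym2 V) (o a₁ a₂ a₃ u b : V) : R :=
  prob p₀ (avoidAll ends a₂ {a₁}) *
      (EQbo p₀ ends o a₁ a₂ b * (prob p₀ (PDEvent ends a₁ a₂ a₃) + prob p₀ (PDEvent ends a₁ a₂ u)) +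
        EQb3 p₀ ends a₁ a₂ u b * Do p₀ ends o a₁ a₂ a₃ -
        EQb3o p₀ ends o a₁ a₂ u b * prob p₀ (PDEvent ends a₁ a₂ a₃)) +
    gap p₀ ends a₁ a₂ b *
      (EQo p₀ ends o a₁ a₂ * (prob p₀ (PDEvent ends a₁ a₂ a₃) + prob p₀ (PDEvent ends a₁ a₂ u)) +
        EQ3 p₀ ends a₁ a₂ u * Do p₀ ends o a₁ a₂ a₃ -
        EQ3o p₀ ends o a₁ a₂ u * prob p₀ (PDEvent ends a₁ a₂ a₃)) +
    prob p₀ (avoidAll ends a₂ {a₁}) *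
      (Do p₀ ends o a₁ a₂ u * PDb p₀ ends a₁ a₂ a₃ b + Do p₀ ends o a₁ a₂ a₃ * PDb p₀ ends a₁ a₂ u b -
        prob p₀ (PDEvent ends a₁ a₂ u) * PDbo p₀ ends o a₁ a₂ a₃ b -
        prob p₀ (PDEvent ends a₁ a₂ a₃) * PDbo p₀ ends o a₁ a₂ u b)

variable {ends : E → Sym2 V} {a₃ u : V} {f : E}
  (hf : ends f = s(a₃, u)) (hleaf : ∀ e, a₃ ∈ ends e → e = f) (h3u : a₃ ≠ u)
  (p : E → R) (o a₁ a₂ b : V) (h3o : o ≠ a₃) (h31 : a₁ ≠ a₃) (h32 : a₂ ≠ a₃) (h3b : b ≠ a₃)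
include hf hleaf h3u h3o h31 h32 h3b

omit [DecidableEq V] [LinearOrder R] in
/-- **The covariance form is quadratic in the pendant weight**:
`Gc(p) = (1 − t)² Gc(p₀) + t (1 − t) · 2β₁′ + t² Gc(p₁)`, `t = p f`. -/
theorem Gc_pendant_quadratic :
    Gc p ends o a₁ a₂ a₃ b =
      (1 - p f) ^ 2 * Gc (Function.update p f 0) ends o a₁ a₂ a₃ b +
        p f * (1 - p f) * twoBeta1 (Function.update p f 0) ends o a₁ a₂ a₃ u b +
        p f ^ 2 * Gc (Function.update p f 1) ends o a₁ a₂ a₃ b := by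
  unfold Gc DEF twoBeta1
  -- the masses at `p`: pinned
  rw [prob_PD_pin (f := f) p a₁ a₂, Do_pin (f := f) p o a₁ a₂, EQb3_pin (f := f) p a₁ a₂ b,
    EQb3o_pin (f := f) p o a₁ a₂ b, EQ3_pin (f := f) p a₁ a₂, EQ3o_pin (f := f) p o a₁ a₂,
    PDb_pin (f := f) p a₁ a₂ b, PDbo_pin (f := f) p o a₁ a₂ b,
    prob_Q_free hf hleaf h3u p a₁ a₂ h31 h32, (EQbo_free hf hleaf h3u p o a₁ a₂ b h3o h31 h32 h3b).1,
    (gap_free hf hleaf h3u p a₁ a₂ b h31 h32 h3b).1, (EQo_free hf hleaf h3u p o a₁ a₂ h3o h31 h32).1]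
  -- the masses at `p₁`: `a₃ := u`
  rw [prob_PD_one hf hleaf h3u p a₁ a₂ h31 h32, Do_one hf hleaf h3u p o a₁ a₂ h3o h31 h32,
    EQb3_one hf hleaf h3u p a₁ a₂ b h31 h32 h3b, EQb3o_one hf hleaf h3u p o a₁ a₂ b h3o h31 h32 h3b,
    EQ3_one hf hleaf h3u p a₁ a₂ h31 h32, EQ3o_one hf hleaf h3u p o a₁ a₂ h3o h31 h32,
    PDb_one hf hleaf h3u p a₁ a₂ b h31 h32 h3b, PDbo_one hf hleaf h3u p o a₁ a₂ b h3o h31 h32 h3b,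
    prob_Q_free' hf hleaf h3u p a₁ a₂ h31 h32, (EQbo_free hf hleaf h3u p o a₁ a₂ b h3o h31 h32 h3b).2,
    (gap_free hf hleaf h3u p a₁ a₂ b h31 h32 h3b).2, (EQo_free hf hleaf h3u p o a₁ a₂ h3o h31 h32).2]
  -- the masses at `p₀`: the `T`-masses vanish
  rw [EQb3_zero hf hleaf h3u p a₁ a₂ b h31 h32, EQb3o_zero hf hleaf h3u p o a₁ a₂ b h31 h32,
    EQ3_zero hf hleaf h3u p a₁ a₂ h31 h32, EQ3o_zero hf hleaf h3u p o a₁ a₂ h31 h32]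
  ring

omit [DecidableEq V] [LinearOrder R] in
/-- **The leaf edge open**: `Gc(p₁)` is `Gc` at `p₀` with `u` in the place of `a₃` (the base instance). -/
theorem Gc_pendant_one :
    Gc (Function.update p f 1) ends o a₁ a₂ a₃ b = Gc (Function.update p f 0) ends o a₁ a₂ u b := by
  unfold Gc DEF
  rw [prob_PD_one hf hleaf h3u p a₁ a₂ h31 h32, Do_one hf hleaf h3u p o a₁ a₂ h3o h31 h32,
    EQb3_one hf hleaf h3u p a₁ a₂ b h31 h32 h3b, EQb3o_one hf hleaf h3u p o a₁ a₂ b h3o h31 h32 h3b,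
    EQ3_one hf hleaf h3u p a₁ a₂ h31 h32, EQ3o_one hf hleaf h3u p o a₁ a₂ h3o h31 h32,
    PDb_one hf hleaf h3u p a₁ a₂ b h31 h32 h3b, PDbo_one hf hleaf h3u p o a₁ a₂ b h3o h31 h32 h3b,
    prob_Q_free' hf hleaf h3u p a₁ a₂ h31 h32, (EQbo_free hf hleaf h3u p o a₁ a₂ b h3o h31 h32 h3b).2,
    (gap_free hf hleaf h3u p a₁ a₂ b h31 h32 h3b).2, (EQo_free hf hleaf h3u p o a₁ a₂ h3o h31 h32).2]

end Dict

section Signs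

variable {V : Type*} {E : Type*} [Fintype E] [DecidableEq E] [Fintype V] [DecidableEq V]
  {R : Type*} [Field R] [LinearOrder R] [IsStrictOrderedRing R]
  {ends : E → Sym2 V} {a₃ u : V} {f : E}
  (hf : ends f = s(a₃, u)) (hleaf : ∀ e, a₃ ∈ ends e → e = f) (h3u : a₃ ≠ u)
  (p : E → R) (o a₁ a₂ b : V) (h3o : o ≠ a₃) (h31 : a₁ ≠ a₃) (h32 : a₂ ≠ a₃) (h3b : b ≠ a₃)
include hf hleaf h3u h3o h31 h32 h3b

omit [Fintype V] [DecidableEq V] h3o h3b in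
/-- **The leaf edge closed**: `Gc(p₀)` is the `a₃`-inactive value `2 P(Q) [S(bL, oH) + S(bH, oL)]`
(the form of `A3Inactive.Gc_eq_of_a3Inactive`, now by probabilities rather than by configurations). -/
theorem Gc_pendant_zero_eq :
    Gc (Function.update p f 0) ends o a₁ a₂ a₃ b =
      2 * prob (Function.update p f 0) (avoidAll ends a₂ {a₁}) *
        ((prob (Function.update p f 0) (avoidAll ends a₂ {a₁} ∩ connEvent ends a₁ b) *
            prob (Function.update p f 0) (avoidAll ends a₂ {a₁} ∩ connEvent ends a₂ o) -
          prob (Function.update p f 0) (avoidAll ends a₂ {a₁}) *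
            prob (Function.update p f 0)
              (avoidAll ends a₂ {a₁} ∩ (connEvent ends a₂ o ∩ connEvent ends a₁ b))) +
         (prob (Function.update p f 0) (avoidAll ends a₂ {a₁} ∩ connEvent ends a₂ b) *
            prob (Function.update p f 0) (avoidAll ends a₂ {a₁} ∩ connEvent ends a₁ o) -
          prob (Function.update p f 0) (avoidAll ends a₂ {a₁}) *
            prob (Function.update p f 0)
              (avoidAll ends a₂ {a₁} ∩ (connEvent ends a₁ o ∩ connEvent ends a₂ b)))) := by
  unfold Gc DEF
  rw [EQb3_zero hf hleaf h3u p a₁ a₂ b h31 h32, EQb3o_zero hf hleaf h3u p o a₁ a₂ b h31 h32,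
    EQ3_zero hf hleaf h3u p a₁ a₂ h31 h32, EQ3o_zero hf hleaf h3u p o a₁ a₂ h31 h32, gap_eq_Q]
  unfold EQbo EQo PDb PDbo Do
  rw [prob_PD_zero' hf hleaf h3u p a₁ a₂ h31 h32]
  simp only [prob_PD_zero hf hleaf h3u p a₁ a₂ h31 h32]
  ring

variable (hp : IsProbVec p)
include hp

omit h3o h3b in
/-- **The `a₃`-inactive coefficient is nonnegative** (BHK 1.4, twice). -/
theorem Gc_pendant_zero_nonneg : 0 ≤ Gc (Function.update p f 0) ends o a₁ a₂ a₃ b := by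
  have hp₀ : IsProbVec (Function.update p f 0) := hp.update f (le_refl _) zero_le_one
  rw [Gc_pendant_zero_eq hf hleaf h3u p o a₁ a₂ b h31 h32]
  have hQ := prob_nonneg hp₀ (avoidAll ends a₂ {a₁})
  have h1 := A3Inactive.bLoH_mul_Q_le (Function.update p f 0) hp₀ ends o a₁ a₂ b
  have h2 := A3Inactive.bHoL_mul_Q_le (Function.update p f 0) hp₀ ends o a₁ a₂ b
  exact mul_nonneg (mul_nonneg (by norm_num) hQ) (by linarith)

/-- **(HCOV) at a pendant `a₃` from the weighted (PM) and the base instance**: if `2β₁′ ≥ 0` and (HCOV)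
holds at `p₀` with `u` in the place of `a₃`, then (HCOV) holds at `p` for the pendant `a₃` — the weighted
analogue of `typedCount_pendant_a3_of_PM` (the `a₃`-inactive class is a theorem here, BHK 1.4). -/
theorem HCov_pendant_of_PM
    (hPM : 0 ≤ twoBeta1 (Function.update p f 0) ends o a₁ a₂ a₃ u b)
    (hbase : HCov (Function.update p f 0) ends o a₁ a₂ u b) : HCov p ends o a₁ a₂ a₃ b := by
  unfold HCov at hbase ⊢
  rw [Gc_pendant_quadratic hf hleaf h3u p o a₁ a₂ b h3o h31 h32 h3b,
    Gc_pendant_one hf hleaf h3u p o a₁ a₂ b h3o h31 h32 h3b]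
  have h0 := Gc_pendant_zero_nonneg hf hleaf h3u p o a₁ a₂ b h31 h32 hp
  have ht0 := hp.nonneg f
  have ht1 : 0 ≤ 1 - p f := sub_nonneg.2 (hp.le_one f)
  have e1 : 0 ≤ (1 - p f) ^ 2 * Gc (Function.update p f 0) ends o a₁ a₂ a₃ b :=
    mul_nonneg (pow_nonneg ht1 2) h0
  have e2 : 0 ≤ p f * (1 - p f) * twoBeta1 (Function.update p f 0) ends o a₁ a₂ a₃ u b :=
    mul_nonneg (mul_nonneg ht0 ht1) hPM
  have e3 : 0 ≤ p f ^ 2 * Gc (Function.update p f 0) ends o a₁ a₂ u b :=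
    mul_nonneg (pow_nonneg ht0 2) hbase
  linarith

end Signs

end PMPendant

end Summit.Ventures.PercRepro2
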